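import Summits.CriticalPhenomena.SAWScalingLimit.Theorems.SAWDevelopingMapObservableToSLERestrictionCocycleHelpersPackage
import Summits.CriticalPhenomena.SAWScalingLimit.Theorems.SAWDevelopingMapHexConjectureAvoidanceCocycleIntegral
import Mathlib.Analysis.Real.Pi.Bounds
import HarnessLib

/-!
# Crux `HexConjecture` (stmt-CriticalPhenomena-0808), line `root-locality-replaces-loewner`,
stub `stub_avoidanceCocycle`, step (b): angular localisation of the phase of `(Ψ')^{5/8}` at a
flat root

Landing target:
`Summits/CriticalPhenomena/SAWScalingLimit/Theorems/SAWDevelopingMapHexConjectureAvoidanceCocycleRootPhase.lean`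
(`--supports stmt-CriticalPhenomena-0808`).

The ratio computation of `stub_avoidanceCocycle` evaluates the limit functional
`I_Ω(ψ) = ∫ ψ · exp ((5/8)(L - L_b))` of `HexObservableLimitR` on the nonnegative root-dominance
bumps `ψ_r` supported in `B(a + i r, r/4)` above the flat root `a = D.pt 0`; comparing `|I_Ω(ψ_r)|`
with `∫ ψ_r |exp ((5/8)(L - L_b))|` needs COHERENT phases there.  With `Ψ = -1/φ⁻¹` (`φ` chordal
uniformizing) and `L` any continuous logarithm of `Ψ'`: `φ⁻¹` has real boundary values along the
flat diameter (Carathéodory) and extends by Schwarz reflection to `F` holomorphic near `a` with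
`F(a) = 0`, `F'(a) > 0`; `Ψ' = F'/F²`, `Im L = Im log F' - 2 arg F + const`,
`arg F(z) = arg (z - a) + o(1)` and `|arg (z - a) - π/2| ≤ π/6` on the ball, whence
`|Im L(z) - Im L(a + i r)| ≤ 3/2` there for small `r` (`abs_im_logDeriv_sub_le_of_flat_root`).
-/

noncomputable section

open scoped Topology Real
open Filter Set Metric Complex
open Literature.Probability.RandomPlanarGeometry
open UpperHalfPlane (upperHalfPlaneSet isOpen_upperHalfPlaneSet)
open Summit.CriticalPhenomena.SAWScalingLimit.Theorems.ObservableToSLE.FloorRatio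
  (flat_of_subset mem_frontier_of_flat exists_log_of_isSimplyConnected isSimplyConnected_ball)

namespace Summit.CriticalPhenomena.SAWScalingLimit.Theorems.HexConjecture.RootLocality.Cocycle

/-! ### The Schwarz reflection of `φ⁻¹` at the root and the phase estimate -/

/-- **Angular localisation of `(Ψ')^{5/8}` above a flat root.**  Let `(D; a, b)` be a Dobrushin
domain which is the horizontal upper half-disc inside `B(a, ρ)`, `φ : (ℍ; 0, ∞) → (D; a, b)` a
chordal uniformizing map, `Ψ = -1/φ⁻¹` and `L` a continuous logarithm of `Ψ'` on `D`.  Then for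
all small `r > 0` the ball `B(a + i r, r/4)` lies in `D` and the imaginary part of `L` varies by
at most `3/2` on it: `|Im L(z) - Im L(a + i r)| ≤ 3/2`.  Proof: Schwarz reflection of `φ⁻¹`
across the diameter (real boundary values by Carathéodory, `F(a) = 0`, `F'(a) ∈ ℝ_{>0}`),
`Ψ' = F'/F²`, `Im L = Im log F' - 2 arg F + const` on the half-disc, `arg F(z) = arg (z - a) +
arg (F(z)/(z - a))` with the second term small, and `|arg (z - a) - π/2| ≤ π/6` on the ball.
[cite: PommerenkeBBCM1992, Thm. 2.6] -/
theorem abs_im_logDeriv_sub_le_of_flat_root (D : DobrushinDomain)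
    (φ : ConformalEquiv upperHalfPlaneSet D.carrier) (hφ : D.IsChordalUniformizing φ)
    {ρ : ℝ} (hρ : 0 < ρ)
    (hflat : D.carrier ∩ ball (D.pt 0) ρ = {z : ℂ | (D.pt 0).im < z.im} ∩ ball (D.pt 0) ρ)
    (Ψ : ConformalEquiv D.carrier upperHalfPlaneSet) (hΨ : ∀ z, Ψ z = -(φ.symm z)⁻¹)
    {L : ℂ → ℂ} (hLc : ContinuousOn L D.carrier)
    (hLe : ∀ z ∈ D.carrier, exp (L z) = deriv Ψ z) :
    ∃ r₁ : ℝ, 0 < r₁ ∧ ∀ r : ℝ, 0 < r → r < r₁ →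
      ∀ z ∈ ball (D.pt 0 + (r : ℂ) * I) (r / 4), z ∈ D.carrier ∧
        |(L z).im - (L (D.pt 0 + (r : ℂ) * I)).im| ≤ 3 / 2 := by
  set a₀ : ℂ := D.pt 0 with ha₀
  set b₀ : ℂ := D.pt 1 with hb₀
  have hab : a₀ ≠ b₀ := fun h => absurd (D.pt_injective h) (by decide)
  set ρ₀ : ℝ := min ρ (dist a₀ b₀) with hρ₀
  have hρ₀pos : 0 < ρ₀ := lt_min hρ (dist_pos.2 hab)
  have hρ₀ρ : ρ₀ ≤ ρ := min_le_left _ _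
  have hflat₀ : D.carrier ∩ ball a₀ ρ₀ = {z : ℂ | a₀.im < z.im} ∩ ball a₀ ρ₀ :=
    flat_of_subset hflat (ball_subset_ball hρ₀ρ) rfl
  have hbv : ∀ t : ℝ, |t| < ρ₀ → ∃ q : ℝ, Tendsto φ.symm (𝓝[D.carrier] (a₀ + t)) (𝓝 (q : ℂ)) := by
    intro t ht
    by_cases ht0 : t = 0
    · subst ht0
      exact ⟨0, by simpa [ha₀] using hφ.tendsto_symm_nhds_zero⟩
    · have hne_a : a₀ + (t : ℂ) ≠ a₀ := fun h => ht0 (by simpa using congrArg Complex.re h)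
      have hne_b : a₀ + (t : ℂ) ≠ b₀ := fun h => by
        have : dist a₀ b₀ = |t| := by
          rw [← h, dist_eq_norm, show a₀ - (a₀ + t) = -(t : ℂ) by ring, norm_neg, norm_real,
            Real.norm_eq_abs]
        linarith [min_le_right ρ (dist a₀ b₀)]
      obtain ⟨q, -, hq⟩ :=
        hφ.exists_tendsto_symm_of_mem_frontier (mem_frontier_of_flat hflat₀ ht) hne_a hne_b
      exact ⟨q, hq⟩
  set W : Set ℂ := upperHalfPlaneSet ∩ ball (0 : ℂ) ρ₀ with hW
  have hWo : IsOpen W := isOpen_upperHalfPlaneSet.inter isOpen_ball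
  have hTW : ∀ w ∈ W, w + a₀ ∈ D.carrier := fun w hw => by
    have : w + a₀ ∈ {z : ℂ | a₀.im < z.im} ∩ ball a₀ ρ₀ :=
      ⟨by show a₀.im < (w + a₀).im; rw [add_im]; linarith [show 0 < w.im from hw.1],
       by rw [mem_ball, dist_eq_norm, add_sub_cancel_right]; exact mem_ball_zero_iff.1 hw.2⟩
    rw [← hflat₀] at this
    exact this.1
  set g : ℂ → ℂ := fun w => φ.symm (w + a₀) with hg
  have hgd : DifferentiableOn ℂ g W :=
    φ.symm.differentiableOn_coe.comp (differentiableOn_id.add_const a₀) fun w hw => hTW w hw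
  have hgim : ∀ w ∈ W, 0 < (g w).im := fun w hw => φ.symm.mapsTo (hTW w hw)
  have htr : ∀ p : ℂ, Tendsto (fun w : ℂ => w + a₀) (𝓝[W] p) (𝓝[D.carrier] (a₀ + p)) := fun p => by
    refine tendsto_nhdsWithin_iff.2 ⟨?_, eventually_nhdsWithin_of_forall fun w hw => hTW w hw⟩
    have hc : Continuous fun w : ℂ => w + a₀ := continuous_id.add continuous_const
    have h := (hc.tendsto p).mono_left (nhdsWithin_le_nhds (s := W))
    rwa [add_comm p a₀] at h
  have hgbv : ∀ t : ℝ, |t| < ρ₀ → ∃ σ : ℝ, Tendsto g (𝓝[W] (t : ℂ)) (𝓝 (σ : ℂ)) := fun t ht => by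
    obtain ⟨σ, hσ⟩ := hbv t ht
    exact ⟨σ, hσ.comp (htr t)⟩
  have hg0 : Tendsto g (𝓝[W] (0 : ℂ)) (𝓝 0) := by
    have h0 := hφ.tendsto_symm_nhds_zero
    rw [← ha₀, ← add_zero a₀] at h0
    exact h0.comp (htr 0)
  -- the continuous extension `G` of `g` to the closed half-disc
  set G : ℂ → ℂ := extendFrom W g with hG
  have hGW : ∀ w ∈ W, G w = g w := extendFrom_extends hgd.continuousOn
  have hGt : ∀ t : ℝ, |t| < ρ₀ → ∃ σ : ℝ, G t = σ := by
    intro t ht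
    obtain ⟨σ, hσ⟩ := hgbv t ht
    exact ⟨σ, extendFrom_eq (ofReal_mem_closure_inter_ball ht) hσ⟩
  have hG0 : G 0 = 0 := by
    have h := extendFrom_eq (ofReal_mem_closure_inter_ball (r := ρ₀) (t := 0) (by simpa using hρ₀pos)) 
      (by simpa using hg0)
    simpa using h
  have habs : ∀ z ∈ ball (0 : ℂ) ρ₀, |z.re| < ρ₀ := fun z hz =>
    (abs_re_le_norm z).trans_lt (mem_ball_zero_iff.1 hz)
  have hre : ∀ z : ℂ, z.im = 0 → ((z.re : ℝ) : ℂ) = z := fun z hz =>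
    Complex.ext (by simp) (by simp [hz])
  have hBsub : ball (0 : ℂ) ρ₀ ∩ {z : ℂ | 0 ≤ z.im} ⊆ closure W := by
    rintro z ⟨hz, hzim⟩
    rcases (show 0 ≤ z.im from hzim).lt_or_eq with hlt | heq
    · exact subset_closure ⟨hlt, hz⟩
    · rw [← hre z heq.symm]
      exact ofReal_mem_closure_inter_ball (habs z hz)
  have hGc : ContinuousOn G (ball (0 : ℂ) ρ₀ ∩ {z : ℂ | 0 ≤ z.im}) := by
    refine continuousOn_extendFrom hBsub ?_
    rintro z ⟨hz, hzim⟩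
    rcases (show 0 ≤ z.im from hzim).lt_or_eq with hlt | heq
    · exact ⟨g z, hgd.continuousOn z ⟨hlt, hz⟩⟩
    · obtain ⟨σ, hσ⟩ := hgbv z.re (habs z hz)
      rw [hre z heq.symm] at hσ
      exact ⟨σ, hσ⟩
  -- Schwarz reflection: `F` holomorphic on `B(0, ρ₀)`, `F = g` on `W`, `F 0 = 0`, `F' 0 ≠ 0`
  set F : ℂ → ℂ := Complex.schwarzReflection G with hF
  have hFd : DifferentiableOn ℂ F (ball (0 : ℂ) ρ₀) := by
    refine Complex.differentiableOn_schwarzReflection isOpen_ball (fun z hz => ?_) hGc ?_ ?_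
    · simpa [mem_ball_zero_iff] using hz
    · have hset : ball (0 : ℂ) ρ₀ ∩ {z : ℂ | 0 < z.im} = W := by
        ext z
        simp only [hW, mem_inter_iff, mem_setOf_eq, upperHalfPlaneSet, and_comm]
      rw [hset]
      exact hgd.congr fun z hz => hGW z hz
    · intro z hz hzim
      obtain ⟨σ, hσ⟩ := hGt z.re (habs z hz)
      rw [← hre z hzim, hσ, conj_ofReal]
  have hFW : ∀ w ∈ W, F w = g w := fun w hw => by
    rw [hF, Complex.schwarzReflection_of_nonneg (le_of_lt hw.1), hGW w hw]
  have hFt : ∀ t : ℝ, |t| < ρ₀ → ∃ σ : ℝ, F t = σ := fun t ht => by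
    rw [hF, Complex.schwarzReflection_ofReal]; exact hGt t ht
  have hF0 : F 0 = 0 := by
    rw [hF, ← ofReal_zero, Complex.schwarzReflection_ofReal, ofReal_zero, hG0]
  have hF'0 : deriv F 0 ≠ 0 :=
    SchwarzReflection.deriv_ne_zero_of_im_pos hρ₀pos hFd hF0 fun w hw => by
      rw [hFW w hw]; exact hgim w hw
  -- `c₁ = F'(0)` is a positive real
  set c₁ : ℂ := deriv F 0 with hc₁
  have hFa : AnalyticOnNhd ℂ F (ball (0 : ℂ) ρ₀) := hFd.analyticOnNhd isOpen_ball
  have hFat : HasDerivAt F c₁ 0 := (hFd.differentiableAt (ball_mem_nhds 0 hρ₀pos)).hasDerivAt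
  set H : ℂ → ℂ := fun w => F w / w with hH
  have hHlim : Tendsto H (𝓝[≠] 0) (𝓝 c₁) := by
    refine (hasDerivAt_iff_tendsto_slope.1 hFat).congr' ?_
    filter_upwards [self_mem_nhdsWithin] with w hw
    rw [slope_def_field, hF0, sub_zero, sub_zero]
  have hc₁im : c₁.im = 0 := by
    -- limit of real slopes along the real axis
    have hpath : Tendsto (fun t : ℝ => (t : ℂ)) (𝓝[≠] 0) (𝓝[≠] 0) := by
      refine tendsto_nhdsWithin_iff.2 ⟨?_, ?_⟩
      · simpa using (continuous_ofReal.tendsto 0).mono_left nhdsWithin_le_nhds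
      · filter_upwards [self_mem_nhdsWithin] with t ht
        rw [mem_compl_singleton_iff] at ht ⊢
        exact_mod_cast ht
    have h1 : Tendsto (fun t : ℝ => H t) (𝓝[≠] 0) (𝓝 c₁) := hHlim.comp hpath
    have hmem : ∀ᶠ t : ℝ in 𝓝[≠] 0, H t ∈ {z : ℂ | z.im = 0} := by
      have hev : ∀ᶠ t : ℝ in 𝓝[≠] (0 : ℝ), |t| < ρ₀ := by
        have : ∀ᶠ t : ℝ in 𝓝 (0 : ℝ), |t| < ρ₀ := by
          filter_upwards [Metric.ball_mem_nhds (0 : ℝ) hρ₀pos] with t ht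
          rwa [mem_ball, dist_zero_right, Real.norm_eq_abs] at ht
        exact mem_nhdsWithin_of_mem_nhds this
      filter_upwards [hev] with t ht
      obtain ⟨σ, hσ⟩ := hFt t ht
      show (F t / t).im = 0
      rw [hσ, ← ofReal_div, ofReal_im]
    exact (isClosed_eq continuous_im continuous_const).mem_of_tendsto h1 hmem
  have hc₁re : 0 < c₁.re := by
    -- `Re (F(it)/(it)) = Im F(it)/t > 0` along the imaginary axis
    have hpath : Tendsto (fun t : ℝ => (t : ℂ) * I) (𝓝[>] 0) (𝓝[≠] 0) := by
      refine tendsto_nhdsWithin_iff.2 ⟨?_, ?_⟩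
      · have : Continuous fun t : ℝ => (t : ℂ) * I := by fun_prop
        simpa using (this.tendsto 0).mono_left nhdsWithin_le_nhds
      · filter_upwards [self_mem_nhdsWithin] with t ht
        have ht' : (0 : ℝ) < t := ht
        exact mul_ne_zero (by exact_mod_cast ht'.ne') I_ne_zero
    have h1 : Tendsto (fun t : ℝ => (H (t * I)).re) (𝓝[>] 0) (𝓝 c₁.re) :=
      (continuous_re.tendsto _).comp (hHlim.comp hpath)
    have hpos : ∀ᶠ t : ℝ in 𝓝[>] 0, 0 < (H (t * I)).re := by
      have hev : ∀ᶠ t : ℝ in 𝓝[>] (0 : ℝ), t < ρ₀ :=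
        mem_nhdsWithin_of_mem_nhds (Iio_mem_nhds hρ₀pos)
      filter_upwards [hev, self_mem_nhdsWithin] with t ht ht0
      have ht0' : (0 : ℝ) < t := ht0
      have hmem : (t : ℂ) * I ∈ W := by
        refine ⟨?_, ?_⟩
        · show 0 < ((t : ℂ) * I).im
          simp [ht0']
        · rw [mem_ball_zero_iff, norm_mul, norm_I, mul_one, norm_real, Real.norm_of_nonneg ht0'.le]
          exact ht
      have hval : (H (t * I)).re = (F (t * I)).im / t := by
        show (F (t * I) / (t * I)).re = _
        have ht1 : (t : ℂ) ≠ 0 := by exact_mod_cast ht0'.ne'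
        rw [div_re]
        simp [normSq_apply]
        field_simp
      rw [hval]
      exact div_pos (by rw [hFW _ hmem]; exact hgim _ hmem) ht0'
    have hge : 0 ≤ c₁.re := ge_of_tendsto h1 (hpos.mono fun t ht => ht.le)
    have hne : c₁.re ≠ 0 := fun h => hF'0 (Complex.ext (by simpa using h) (by simpa using hc₁im))
    exact lt_of_le_of_ne hge (Ne.symm hne)
  have hc₁real : ((c₁.re : ℝ) : ℂ) = c₁ := Complex.ext (by simp) (by simp [hc₁im])
  have hc₁slit : c₁ ∈ slitPlane := Or.inl hc₁re
  have hargc₁ : arg c₁ = 0 := by rw [← hc₁real]; exact arg_ofReal_of_nonneg hc₁re.le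
  -- `arg (F w / w) → 0`: the radius `r₂`
  have hargH : Tendsto (fun w => arg (H w)) (𝓝[≠] 0) (𝓝 0) := by
    have h := ((continuousAt_arg hc₁slit).tendsto).comp hHlim
    rwa [hargc₁] at h
  obtain ⟨r₂, hr₂, hr₂H⟩ : ∃ r₂ > 0, ∀ w : ℂ, w ≠ 0 → ‖w‖ < r₂ → |arg (H w)| < 1 / 16 := by
    have hev : ∀ᶠ w in 𝓝[≠] (0 : ℂ), |arg (H w)| < 1 / 16 := by
      filter_upwards [hargH (Metric.ball_mem_nhds (0 : ℝ) (by norm_num : (0 : ℝ) < 1 / 16))]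
        with w hw
      rwa [mem_preimage, mem_ball, dist_zero_right, Real.norm_eq_abs] at hw
    rw [eventually_nhdsWithin_iff, Metric.eventually_nhds_iff_ball] at hev
    obtain ⟨r₂, hr₂, h⟩ := hev
    exact ⟨r₂, hr₂, fun w hw0 hw => h w (mem_ball_zero_iff.2 hw) hw0⟩
  -- `F'` is continuous and nonzero near `0`: the radius `r₁'` and the logarithm `ℓ` of `F'`
  have hF'c : ContinuousOn (deriv F) (ball (0 : ℂ) ρ₀) := (hFa.deriv).continuousOn
  obtain ⟨r₁', hr₁', hr₁'ρ, hne⟩ : ∃ r₁', 0 < r₁' ∧ r₁' ≤ ρ₀ ∧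
      ∀ z ∈ ball (0 : ℂ) r₁', deriv F z ≠ 0 := by
    have hca : ContinuousAt (deriv F) 0 := hF'c.continuousAt (ball_mem_nhds 0 hρ₀pos)
    obtain ⟨r₁, hr₁, h⟩ := Metric.eventually_nhds_iff_ball.1 (hca.eventually_ne hF'0)
    exact ⟨min r₁ ρ₀, lt_min hr₁ hρ₀pos, min_le_right _ _,
      fun z hz => h z (ball_subset_ball (min_le_left _ _) hz)⟩
  obtain ⟨ℓ, hℓc, hℓe⟩ := exists_log_of_isSimplyConnected isOpen_ball (isSimplyConnected_ball 0 hr₁')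
    (hF'c.mono (ball_subset_ball hr₁'ρ)) hne
  -- the radius `r₃`: `‖ℓ w - ℓ 0‖ < 1/16`
  obtain ⟨r₃, hr₃, hr₃ℓ⟩ : ∃ r₃ > 0, ∀ w : ℂ, ‖w‖ < r₃ → ‖ℓ w - ℓ 0‖ < 1 / 16 := by
    have hca : ContinuousAt ℓ 0 := hℓc.continuousAt (ball_mem_nhds 0 hr₁')
    obtain ⟨r₃, hr₃, h⟩ := Metric.eventually_nhds_iff_ball.1
      (Metric.tendsto_nhds.1 hca.tendsto _ (by norm_num : (0 : ℝ) < 1 / 16))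
    exact ⟨r₃, hr₃, fun w hw => by
      have := h w (mem_ball_zero_iff.2 hw); rwa [dist_eq_norm] at this⟩
  -- on the small half-disc `W₁`: `L (w + a₀) = ℓ w - 2 log (F w) + κ₀`
  set W₁ : Set ℂ := upperHalfPlaneSet ∩ ball (0 : ℂ) r₁' with hW₁
  have hW₁W : W₁ ⊆ W := fun z hz => ⟨hz.1, ball_subset_ball hr₁'ρ hz.2⟩
  have hW₁o : IsOpen W₁ := isOpen_upperHalfPlaneSet.inter isOpen_ball
  have hderiv : ∀ w ∈ W₁, deriv F w = deriv φ.symm (w + a₀) := by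
    intro w hw
    have hev : F =ᶠ[𝓝 w] g := by
      filter_upwards [hWo.mem_nhds (hW₁W hw)] with v hv
      exact hFW v hv
    rw [hev.deriv_eq, hg]
    exact deriv_comp_add_const _ _ _
  have hΨder : ∀ z ∈ D.carrier, φ.symm z ≠ 0 ∧ deriv Ψ z = deriv φ.symm z / φ.symm z ^ 2 := by
    intro z hz
    have hg0 : φ.symm z ≠ 0 := by
      intro h
      have : (0 : ℂ) ∈ upperHalfPlaneSet := by rw [← h]; exact φ.symm.mapsTo hz
      exact absurd this (by simp [upperHalfPlaneSet])
    have hgd' : HasDerivAt (φ.symm : ℂ → ℂ) (deriv φ.symm z) z :=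
      (φ.symm.differentiableOn_coe.differentiableAt (D.isOpen.mem_nhds hz)).hasDerivAt
    have hΨd : HasDerivAt Ψ (deriv φ.symm z / φ.symm z ^ 2) z := by
      have h1 := (hgd'.fun_inv hg0).fun_neg
      have heq : (Ψ : ℂ → ℂ) = fun w ↦ -(φ.symm w)⁻¹ := funext hΨ
      rw [heq]
      refine h1.congr_deriv ?_
      ring
    exact ⟨hg0, hΨd.deriv⟩
  have hFne : ∀ w ∈ W₁, F w ≠ 0 := fun w hw h => by
    have := hgim w (hW₁W hw)
    rw [← hFW w (hW₁W hw), h, zero_im] at this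
    exact lt_irrefl _ this
  have hFslit : ∀ w ∈ W₁, F w ∈ slitPlane := fun w hw =>
    Or.inr (by rw [hFW w (hW₁W hw)]; exact (hgim w (hW₁W hw)).ne')
  have hk : ∀ w ∈ W₁, exp (L (w + a₀) - ℓ w + 2 * log (F w)) = 1 := by
    intro w hw
    have hzD : w + a₀ ∈ D.carrier := hTW w (hW₁W hw)
    obtain ⟨hg0, hΨz⟩ := hΨder _ hzD
    have hF0w : F w ≠ 0 := hFne w hw
    have hF'w : deriv F w ≠ 0 := hne w hw.2
    have hFg : φ.symm (w + a₀) = F w := (hFW w (hW₁W hw)).symm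
    have h2 : exp (2 * log (F w)) = F w ^ 2 := by
      rw [show (2 : ℂ) * log (F w) = ((2 : ℕ) : ℂ) * log (F w) by norm_num, Complex.exp_nat_mul,
        Complex.exp_log hF0w]
    have hF'w' : deriv φ.symm (w + a₀) ≠ 0 := hderiv w hw ▸ hF'w
    rw [Complex.exp_add, Complex.exp_sub, hLe _ hzD, hΨz, hℓe w hw.2, hderiv w hw, hFg, h2]
    field_simp
  have hW₁c : IsPreconnected W₁ :=
    ((convex_halfSpace_im_gt 0).inter (convex_ball (0 : ℂ) r₁')).isPreconnected
  have hcontk : ContinuousOn (fun w => L (w + a₀) - ℓ w + 2 * log (F w)) W₁ := by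
    refine (ContinuousOn.sub ?_ (hℓc.mono fun z hz => hz.2)).add
      (continuousOn_const.mul ((hFd.continuousOn.mono fun z hz => ball_subset_ball hr₁'ρ hz.2).clog
        hFslit))
    exact hLc.comp (continuous_id.add continuous_const).continuousOn fun z hz => hTW z (hW₁W hz)
  set z₁ : ℂ := I * ((r₁' / 2 : ℝ) : ℂ) with hz₁
  have hz₁W : z₁ ∈ W₁ := by
    refine ⟨?_, ?_⟩
    · show 0 < z₁.im
      simp [hz₁, hr₁']
    · rw [mem_ball_zero_iff, hz₁, norm_mul, norm_I, one_mul, norm_real,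
        Real.norm_of_nonneg (by positivity)]
      linarith
  set κ₀ : ℂ := L (z₁ + a₀) - ℓ z₁ + 2 * log (F z₁) with hκ₀
  have hconst : ∀ w ∈ W₁, L (w + a₀) - ℓ w + 2 * log (F w) = κ₀ := by
    intro w hw
    refine hW₁c.constant_of_mapsTo (T := ((AddSubgroup.zmultiples (2 * π * I) : AddSubgroup ℂ) :
      Set ℂ)) ?_ hcontk ?_ hw hz₁W
    · exact SetLike.isDiscrete_iff_discreteTopology.2 inferInstance
    · intro v hv
      obtain ⟨n, hn⟩ := Complex.exp_eq_one_iff.1 (hk v hv)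
      show L (v + a₀) - ℓ v + 2 * log (F v) ∈ _
      rw [hn]
      exact ⟨n, by simp [zsmul_eq_mul]⟩
  have him_eq : ∀ w ∈ W₁, (L (w + a₀)).im = (ℓ w).im - 2 * arg (F w) + κ₀.im := by
    intro w hw
    have h := congrArg Complex.im (hconst w hw)
    simp only [sub_im, add_im, mul_im, Complex.log_im, re_ofNat, im_ofNat] at h
    linarith
  -- `arg F = arg w + arg (F w / w)` when `|arg w - π/2| ≤ π/6` and `|arg (F w / w)| < 1/16`
  have hargF : ∀ w ∈ W₁, w ≠ 0 → ‖w‖ < r₂ → |arg w - π / 2| ≤ π / 6 →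
      arg (F w) = arg w + arg (H w) := by
    intro w hw hw0 hwr₂ hargw
    have hH0 : H w ≠ 0 := div_ne_zero (hFne w hw) hw0
    have hFw : F w = w * H w := by rw [hH]; field_simp
    have hb := hr₂H w hw0 hwr₂
    rw [hFw, (arg_mul_eq_add_arg_iff hw0 hH0).2]
    obtain ⟨h1, h2⟩ := abs_le.1 hargw
    obtain ⟨h3, h4⟩ := abs_lt.1 hb
    constructor <;> nlinarith [Real.pi_gt_three, Real.pi_lt_d2]
  -- the final radius
  set r₁ : ℝ := 4 / 5 * min r₁' (min r₂ r₃) with hr₁def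
  have hm0 : 0 < min r₁' (min r₂ r₃) := lt_min hr₁' (lt_min hr₂ hr₃)
  refine ⟨r₁, by positivity, fun r hr hrr₁ z hz => ?_⟩
  have h54 : 5 * r / 4 < min r₁' (min r₂ r₃) := by rw [hr₁def] at hrr₁; linarith
  have h54a : 5 * r / 4 < r₁' := h54.trans_le (min_le_left _ _)
  have h54b : 5 * r / 4 < r₂ := h54.trans_le ((min_le_right _ _).trans (min_le_left _ _))
  have h54c : 5 * r / 4 < r₃ := h54.trans_le ((min_le_right _ _).trans (min_le_right _ _))
  -- the points `w = z - a₀` and `w_r = i r`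
  set w : ℂ := z - a₀ with hwdef
  have hzw : z = w + a₀ := by rw [hwdef, sub_add_cancel]
  have hwball : w ∈ ball ((r : ℂ) * I) (r / 4) := by
    rw [mem_ball, dist_eq_norm] at hz ⊢
    rw [hwdef, show z - a₀ - r * I = z - (a₀ + r * I) by ring]
    exact hz
  obtain ⟨hwim, hwnorm, hw0, hwarg⟩ := ball_I_mul_geometry hr hwball
  have hwW₁ : w ∈ W₁ := ⟨hwim, mem_ball_zero_iff.2 (hwnorm.trans h54a)⟩
  set wr : ℂ := (r : ℂ) * I with hwrdef
  have hwrim : 0 < wr.im := by simp [hwrdef, hr]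
  have hwrnorm : ‖wr‖ = r := by
    rw [hwrdef, norm_mul, norm_I, mul_one, norm_real, Real.norm_of_nonneg hr.le]
  have hwr0 : wr ≠ 0 := fun h => by rw [h, zero_im] at hwrim; exact lt_irrefl _ hwrim
  have hrlt : r < 5 * r / 4 := by linarith
  have hwrW₁ : wr ∈ W₁ := ⟨hwrim, mem_ball_zero_iff.2 (by rw [hwrnorm]; linarith)⟩
  have hargwr : arg wr = π / 2 := by rw [hwrdef, arg_real_mul I hr, arg_I]
  have hcentre : D.pt 0 + (r : ℂ) * I = wr + a₀ := by rw [hwrdef, ha₀, add_comm]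
  refine ⟨hzw ▸ hTW w (hW₁W hwW₁), ?_⟩
  rw [hzw, hcentre, him_eq w hwW₁, him_eq wr hwrW₁,
    hargF w hwW₁ hw0 (hwnorm.trans h54b) hwarg,
    hargF wr hwrW₁ hwr0 (by rw [hwrnorm]; linarith) (by rw [hargwr, sub_self, abs_zero]; positivity),
    hargwr]
  -- the estimate
  have hℓ : |(ℓ w).im - (ℓ wr).im| ≤ 1 / 8 := by
    have h1 := hr₃ℓ w (hwnorm.trans h54c)
    have h2 := hr₃ℓ wr (by rw [hwrnorm]; linarith)
    have h3 : |(ℓ w).im - (ℓ wr).im| ≤ ‖ℓ w - ℓ wr‖ := by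
      rw [← sub_im]; exact abs_im_le_norm _
    have h4 : ‖ℓ w - ℓ wr‖ ≤ ‖ℓ w - ℓ 0‖ + ‖ℓ wr - ℓ 0‖ := by
      rw [← norm_neg (ℓ wr - ℓ 0)]
      refine (norm_add_le _ _).trans' (le_of_eq ?_)
      congr 1; ring
    linarith
  have hHw := hr₂H w hw0 (hwnorm.trans h54b)
  have hHwr := hr₂H wr hwr0 (by rw [hwrnorm]; linarith)
  obtain ⟨h1, h2⟩ := abs_le.1 hℓ
  obtain ⟨h3, h4⟩ := abs_lt.1 hHw
  obtain ⟨h5, h6⟩ := abs_lt.1 hHwr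
  obtain ⟨h7, h8⟩ := abs_le.1 hwarg
  rw [abs_le]
  constructor <;> nlinarith [Real.pi_gt_three, Real.pi_lt_d2]

/-- **Registered form `stub_avoidanceCocycle_rootPhase`** (crux item stmt-CriticalPhenomena-0808, line
`root-locality-replaces-loewner`, stub `stub_avoidanceCocycle`, step (b)): angular localisation of the
phase of `log Ψ'` above a flat root (`abs_im_logDeriv_sub_le_of_flat_root`).
[cite: PommerenkeBBCM1992, Thm. 2.6] -/
theorem stub_avoidanceCocycle_rootPhase : ∀ (D : Literature.Probability.RandomPlanarGeometry.DobrushinDomain) (φ : Literature.Probability.RandomPlanarGeometry.ConformalEquiv UpperHalfPlane.upperHalfPlaneSet D.carrier) (ρ : ℝ) (Ψ : Literature.Probability.RandomPlanarGeometry.ConformalEquiv D.carrier UpperHalfPlane.upperHalfPlaneSet) (L : ℂ → ℂ), D.IsChordalUniformizing φ → 0 < ρ → D.carrier ∩ Metric.ball (D.pt 0) ρ = {z : ℂ | (D.pt 0).im < z.im} ∩ Metric.ball (D.pt 0) ρ → (∀ z, Ψ z = -(φ.symm z)⁻¹) → ContinuousOn L D.carrier → (∀ z ∈ D.carrier, Complex.exp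 (L z) = deriv Ψ z) → ∃ r₁ : ℝ, 0 < r₁ ∧ ∀ r : ℝ, 0 < r → r < r₁ → ∀ z ∈ Metric.ball (D.pt 0 + (r : ℂ) * Complex.I) (r / 4), z ∈ D.carrier ∧ |(L z).im - (L (D.pt 0 + (r : ℂ) * Complex.I)).im| ≤ 3 / 2 :=
  fun D φ _ Ψ _ hφ hρ hflat hΨ hLc hLe =>
    abs_im_logDeriv_sub_le_of_flat_root D φ hφ hρ hflat Ψ hΨ hLc hLe

end Summit.CriticalPhenomena.SAWScalingLimit.Theorems.HexConjecture.RootLocality.Cocycle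

end
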